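import Mathlib
import HarnessLib
import Summits.Ventures.LatticeQCDFlow.Exactness.SphereFlowLightCone
import Summits.Ventures.LatticeQCDFlow.Exactness.SphereLOFlowL1Stability

/-!
# The light cone of the exact leading-order trivializing flow of the lattice CP(N−1)/O(N) action: read sets = coupling neighbourhoods, rate `K = 3|κ|υ/(d−1)`, tail `2·e^{K|t|}(K|t|)^{m+1}/(m+1)!` at coupling distance `m + 1`, receptive radius independent of the volume

HONEST FRAMING: exact (Metropolis-corrected) sampling algorithms for lattice gauge theory;
figures of merit are autocorrelation/cost numbers at stated couplings and volumes; no
continuum-physics claim.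

Venture `LatticeQCDFlow` (cell pub-lqcd), topic `Exactness`; FANOUT row 7 (`s0-cpn-null`: the
S0-D1 rung — 2D CP⁹, Lüscher's LO trivializing map inside HMC, Engel–Schaefer 2011).  NEW WORK of
the cell over this leg's `Exactness/SphereFlowLightCone.lean` (THEOREM L for the sphere flow, ball
form, receptive field) and `Exactness/SphereLOFlowL1Stability.lean` (the tangential projection is
Lipschitz in both arguments, `‖J_n(x) − J_n(y)‖ ≤ Σ_m‖U_nm‖‖x_m − y_m‖`), GEN-9's
`Exactness/SphereLuscherSeriesLocalityES.lean` (`couplingNbhd U n = {m | U_nm ≠ 0}`) and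
`Exactness/SphereLOFlowAction.lean` (E–S eq. (16): `T_n = (κ/(d−1))·P_{x_n}J_n`); nothing is cited
as a fact.  Printed counterpart, NAMED ONLY: G. P. Engel, S. Schaefer, Comput. Phys. Commun. 182
(2011) 2107, §3 eqs. (14)–(16) (the LO generator at site `n` reads `n` and its coupled neighbours
only); M. Lüscher, Commun. Math. Phys. 293 (2010) 899, §4.5 (locality of flow-defined maps).
Gauge-side counterpart: T7/T8 of `StatementLocality.lean` (truncated Wilson flows on `SU(n)^E`).

## Setting

`E` finite-dimensional, `d = dim E ≥ 2`; `Λ` finite; E–S couplings `U` (no self-coupling, adjoint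
pairs, local weight `Σ_m‖U_km‖ ≤ υ`); `S̃⁽⁰⁾ = loFlowAction κ S₀ U`; `Φ_{t₀→t₁}` the exact flow of the
constant generator `S̃⁽⁰⁾` (`sphereTDFlow`, horizon `T`); READ SETS `N n = {n} ∪ couplingNbhd U n`;
`K = 3|κ|υ/(d−1)`.

## Content

* **`norm_siteGrad_loFlowAction_sub_le_of_readSet`** — THE SUP-MODULUS OF THE LO GENERATOR: for
  `x, y ∈ Ω̃` with `‖x_j − y_j‖ ≤ M` on `N n`, `‖∂̃_nS̃⁽⁰⁾(x) − ∂̃_nS̃⁽⁰⁾(y)‖ ≤ K·M`.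
* **`norm_loFlow_sub_le_of_eqOn_nball`** — THE LIGHT CONE OF THE EXACT LO FLOW: if `x, y ∈ Ω̃`
  agree on the coupling ball `nball N m n₀`, then
  `‖Φ_{t₀→t₁}(x)_{n₀} − Φ_{t₀→t₁}(y)_{n₀}‖ ≤ 2·e^{K|t₁−t₀|}·(K|t₁−t₀|)^{m+1}/(m+1)!` — EVERY VOLUME,
  constants `(κ, υ, d, |t₁ − t₀|)` only.
* `norm_loFlow_sub_le_exp` — the sup-Lipschitz constant `e^{K|t₁−t₀|}` of the exact LO flow map.
* **`exists_local_approx_loFlow`** — THE RECEPTIVE FIELD OF THE EXACT LO TRIVIALIZING MAP: for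
  every radius `m` there is a strictly local map `Ψ` (component `n` reads `nball N m n` only) with
  `‖Φ_{t₀→t₁}(x)_n − Ψ(x)_n‖ ≤ 2·e^{K|t₁−t₀|}(K|t₁−t₀|)^{m+1}/(m+1)!` on `Ω̃` — the receptive radius
  for per-site accuracy `ε` depends on `κυ|t₁−t₀|/(d−1)` and `ε`, NOT on `|Λ|` (the cell's theory
  question "how must the network size scale with the volume": for the exact LO map, per site, not
  at all).

NOT CLAIMED: the higher-order generators `S̃⁽ᵏ⁾` (their read sets grow like `2(k+1)`,
`SphereLuscherGeneratorLocality`; a sup-Lipschitz modulus for them is not derived here); sharpness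
of the cone; the one-step map run by the rung (it is strictly local by construction); numbers of
the rung.
-/

noncomputable section

namespace Summit.Ventures.LatticeQCDFlow.Exactness

open Function Set Metric NormedSpace InnerProductSpace
open scoped RealInnerProductSpace Topology Nat

variable {Λ : Type*} {E : Type*} [NormedAddCommGroup E] [InnerProductSpace ℝ E]
  [FiniteDimensional ℝ E] [Fintype Λ] [DecidableEq Λ] {U : Λ → Λ → (E →L[ℝ] E)} {T : ℝ}

/-! ## §1 The sup-modulus of the leading-order generator on its read sets -/

section Modulus

omit [FiniteDimensional ℝ E] [DecidableEq Λ] in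
/-- On the read set `{n} ∪ couplingNbhd U n`, the local field difference is controlled:
`‖J_n(x) − J_n(y)‖ ≤ υ·M` whenever `‖x_m − y_m‖ ≤ M` for every coupled neighbour `m` of `n`. -/
theorem norm_localField_sub_le_of_readSet {υ : ℝ} (hυ : ∀ k, ∑ m, ‖U k m‖ ≤ υ) (n : Λ)
    {x y : Λ → E} {M : ℝ} (hM : 0 ≤ M)
    (hN : ∀ j ∈ insert n (couplingNbhd U n), ‖x j - y j‖ ≤ M) :
    ‖localField U n x - localField U n y‖ ≤ υ * M := by
  refine (norm_localField_sub_le U n x y).trans ?_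
  have hterm : ∀ m, ‖U n m‖ * ‖x m - y m‖ ≤ ‖U n m‖ * M := by
    intro m
    by_cases hm : U n m = 0
    · rw [hm, norm_zero, zero_mul, zero_mul]
    · exact mul_le_mul_of_nonneg_left (hN m (mem_insert_of_mem _ hm)) (norm_nonneg _)
  calc ∑ m, ‖U n m‖ * ‖x m - y m‖ ≤ ∑ m, ‖U n m‖ * M := Finset.sum_le_sum fun m _ => hterm m
    _ = (∑ m, ‖U n m‖) * M := by rw [Finset.sum_mul]
    _ ≤ υ * M := mul_le_mul_of_nonneg_right (hυ n) hM

/-- **THE SUP-MODULUS OF THE LEADING-ORDER GENERATOR.**  For the E–S action (`d ≥ 2`, no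
self-coupling, adjoint pairs, local weight `≤ υ`), `x, y ∈ Ω̃`, a site `n` and `M ≥ 0` with
`‖x_j − y_j‖ ≤ M` for all `j ∈ {n} ∪ couplingNbhd U n`:
`‖∂̃_nS̃⁽⁰⁾(x) − ∂̃_nS̃⁽⁰⁾(y)‖ ≤ (3|κ|υ/(d−1))·M`. -/
theorem norm_siteGrad_loFlowAction_sub_le_of_readSet (hU0 : ∀ n, U n n = 0)
    (hUadj : ∀ m n (v w : E), ⟪U m n v, w⟫ = ⟪v, U n m w⟫) (hd : 2 ≤ Module.finrank ℝ E)
    (κ S₀ : ℝ) {υ : ℝ} (hυ : ∀ k, ∑ m, ‖U k m‖ ≤ υ)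
    {x y : Λ → E} (hx : ∀ n, ‖x n‖ = 1) (hy : ∀ n, ‖y n‖ = 1) (n : Λ) {M : ℝ} (hM : 0 ≤ M)
    (hN : ∀ j ∈ insert n (couplingNbhd U n), ‖x j - y j‖ ≤ M) :
    ‖siteGrad n (loFlowAction κ S₀ U) x - siteGrad n (loFlowAction κ S₀ U) y‖ ≤
      3 * |κ| * υ / ((Module.finrank ℝ E : ℝ) - 1) * M := by
  have hd1 : 0 < (Module.finrank ℝ E : ℝ) - 1 := by
    have : (2 : ℝ) ≤ Module.finrank ℝ E := by exact_mod_cast hd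
    linarith
  have ex : siteGrad n (loFlowAction κ S₀ U) x = -loGenerator κ S₀ U n x := by
    rw [loGenerator, neg_neg]
  have ey : siteGrad n (loFlowAction κ S₀ U) y = -loGenerator κ S₀ U n y := by
    rw [loGenerator, neg_neg]
  rw [ex, ey, loGenerator_eq hU0 hUadj hd κ S₀ (hx n), loGenerator_eq hU0 hUadj hd κ S₀ (hy n),
    neg_sub_neg, ← smul_sub, norm_smul, norm_sub_rev, Real.norm_eq_abs, abs_div, abs_of_pos hd1]
  have hP := norm_tangentKick_sub_tangentKick_le (hx n) (hy n) (localField U n x) (localField U n y)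
  have hJ : ‖localField U n x‖ ≤ υ := norm_localField_le hυ hx n
  have hJd : ‖localField U n x - localField U n y‖ ≤ υ * M := norm_localField_sub_le_of_readSet hυ n hM hN
  have hn : ‖x n - y n‖ ≤ M := hN n (mem_insert _ _)
  have hυ0 : 0 ≤ υ := le_trans (norm_nonneg _) hJ
  calc |κ| / ((Module.finrank ℝ E : ℝ) - 1) *
        ‖tangentKick (localField U n x) (x n) - tangentKick (localField U n y) (y n)‖
      ≤ |κ| / ((Module.finrank ℝ E : ℝ) - 1) * (υ * M + 2 * υ * M) := by
        refine mul_le_mul_of_nonneg_left (hP.trans ?_) (div_nonneg (abs_nonneg _) hd1.le)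
        gcongr ?_ + 2 * ?_ * ?_
    _ = 3 * |κ| * υ / ((Module.finrank ℝ E : ℝ) - 1) * M := by ring

end Modulus

/-! ## §2 The light cone and the receptive field of the exact leading-order flow -/

section Cone

/-- **THE LIGHT CONE OF THE EXACT LO TRIVIALIZING FLOW, UNIFORMLY IN THE VOLUME.**  For the E–S
action (`d ≥ 2`, no self-coupling, adjoint pairs, local weight `≤ υ`), read sets
`N n = {n} ∪ couplingNbhd U n`, and `x, y ∈ Ω̃` agreeing on the coupling ball `nball N m n₀`:
`‖Φ_{t₀→t₁}(x)_{n₀} − Φ_{t₀→t₁}(y)_{n₀}‖ ≤ 2·exp(K|t₁−t₀|)·(K|t₁−t₀|)^{m+1}/(m+1)!`, `K = 3|κ|υ/(d−1)`. -/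
theorem norm_loFlow_sub_le_of_eqOn_nball (hU0 : ∀ n, U n n = 0)
    (hUadj : ∀ m n (v w : E), ⟪U m n v, w⟫ = ⟪v, U n m w⟫) (hd : 2 ≤ Module.finrank ℝ E)
    (κ S₀ : ℝ) {υ : ℝ} (hυ : ∀ k, ∑ m, ‖U k m‖ ≤ υ)
    {x y : Λ → E} (hx : ∀ n, ‖x n‖ = 1) (hy : ∀ n, ‖y n‖ = 1) (t₀ t₁ : ℝ) (n₀ : Λ) (m : ℕ)
    (hagree : ∀ j ∈ nball (fun n => insert n (couplingNbhd U n)) m n₀, x j = y j) :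
    ‖sphereTDFlow (G := fun _ : ℝ => loFlowAction κ S₀ U)
          (contDiff_const_family (contDiff_loFlowAction U κ S₀)) T t₀ t₁ x n₀ -
        sphereTDFlow (G := fun _ : ℝ => loFlowAction κ S₀ U)
          (contDiff_const_family (contDiff_loFlowAction U κ S₀)) T t₀ t₁ y n₀‖ ≤
      2 * Real.exp (3 * |κ| * υ / ((Module.finrank ℝ E : ℝ) - 1) * |t₁ - t₀|) *
        (3 * |κ| * υ / ((Module.finrank ℝ E : ℝ) - 1) * |t₁ - t₀|) ^ (m + 1) / ((m + 1)! : ℝ) := by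
  have hd1 : 0 < (Module.finrank ℝ E : ℝ) - 1 := by
    have : (2 : ℝ) ≤ Module.finrank ℝ E := by exact_mod_cast hd
    linarith
  have hυ0 : 0 ≤ υ := le_trans (Finset.sum_nonneg fun m _ => norm_nonneg _) (hυ n₀)
  have hK : 0 ≤ 3 * |κ| * υ / ((Module.finrank ℝ E : ℝ) - 1) := div_nonneg (by positivity) hd1.le
  exact norm_sphereTDFlow_sub_le_of_eqOn_nball (G := fun _ : ℝ => loFlowAction κ S₀ U)
    (contDiff_const_family (contDiff_loFlowAction U κ S₀)) (fun n => insert n (couplingNbhd U n)) hK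
    (fun _ _ x' y' hx' hy' i M hM hN =>
      norm_siteGrad_loFlowAction_sub_le_of_readSet hU0 hUadj hd κ S₀ hυ hx' hy' i hM hN)
    hx hy n₀ m hagree

/-- **The sup-Lipschitz constant of the exact LO flow map**: for `x, y ∈ Ω̃` with `‖x_j − y_j‖ ≤ δ`
everywhere, `‖Φ_{t₀→t₁}(x)_n − Φ_{t₀→t₁}(y)_n‖ ≤ δ·exp((3|κ|υ/(d−1))·|t₁ − t₀|)` at every site. -/
theorem norm_loFlow_sub_le_exp (hU0 : ∀ n, U n n = 0)
    (hUadj : ∀ m n (v w : E), ⟪U m n v, w⟫ = ⟪v, U n m w⟫) (hd : 2 ≤ Module.finrank ℝ E)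
    (κ S₀ : ℝ) {υ : ℝ} (hυ : ∀ k, ∑ m, ‖U k m‖ ≤ υ)
    {x y : Λ → E} (hx : ∀ n, ‖x n‖ = 1) (hy : ∀ n, ‖y n‖ = 1) (t₀ t₁ : ℝ) {δ : ℝ} (hδ : 0 ≤ δ)
    (h0 : ∀ j, ‖x j - y j‖ ≤ δ) (n : Λ) :
    ‖sphereTDFlow (G := fun _ : ℝ => loFlowAction κ S₀ U)
          (contDiff_const_family (contDiff_loFlowAction U κ S₀)) T t₀ t₁ x n -
        sphereTDFlow (G := fun _ : ℝ => loFlowAction κ S₀ U)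
          (contDiff_const_family (contDiff_loFlowAction U κ S₀)) T t₀ t₁ y n‖ ≤
      δ * Real.exp (3 * |κ| * υ / ((Module.finrank ℝ E : ℝ) - 1) * |t₁ - t₀|) := by
  have hd1 : 0 < (Module.finrank ℝ E : ℝ) - 1 := by
    have : (2 : ℝ) ≤ Module.finrank ℝ E := by exact_mod_cast hd
    linarith
  have hυ0 : 0 ≤ υ := le_trans (Finset.sum_nonneg fun m _ => norm_nonneg _) (hυ n)
  have hK : 0 ≤ 3 * |κ| * υ / ((Module.finrank ℝ E : ℝ) - 1) := div_nonneg (by positivity) hd1.le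
  exact norm_sphereTDFlow_sub_le_exp (G := fun _ : ℝ => loFlowAction κ S₀ U)
    (contDiff_const_family (contDiff_loFlowAction U κ S₀)) (fun n => insert n (couplingNbhd U n)) hK
    (fun _ _ x' y' hx' hy' i M hM hN =>
      norm_siteGrad_loFlowAction_sub_le_of_readSet hU0 hUadj hd κ S₀ hυ hx' hy' i hM hN)
    hx hy hδ h0 n

/-- **THE RECEPTIVE FIELD OF THE EXACT LO TRIVIALIZING MAP IS VOLUME-INDEPENDENT.**  For the E–S
action (`d ≥ 2`, no self-coupling, adjoint pairs, local weight `≤ υ`), every radius `m` and every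
reference configuration `e ∈ Ω̃`, there is a map `Ψ` whose `n`-th component depends only on the sites
of the coupling ball `nball N m n` (`N n = {n} ∪ couplingNbhd U n`), with
`‖Φ_{t₀→t₁}(x)_n − Ψ(x)_n‖ ≤ 2·exp(K|t₁−t₀|)·(K|t₁−t₀|)^{m+1}/(m+1)!` for all `x ∈ Ω̃` and all `n`,
`K = 3|κ|υ/(d−1)`. -/
theorem exists_local_approx_loFlow (hU0 : ∀ n, U n n = 0)
    (hUadj : ∀ m n (v w : E), ⟪U m n v, w⟫ = ⟪v, U n m w⟫) (hd : 2 ≤ Module.finrank ℝ E)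
    (κ S₀ : ℝ) {υ : ℝ} (hυ : ∀ k, ∑ m, ‖U k m‖ ≤ υ) (t₀ t₁ : ℝ) (m : ℕ)
    {e : Λ → E} (he : ∀ n, ‖e n‖ = 1) :
    ∃ Ψ : (Λ → E) → (Λ → E),
      (∀ n, DependsOn (fun x => Ψ x n) (nball (fun n => insert n (couplingNbhd U n)) m n)) ∧
      ∀ x : Λ → E, (∀ n, ‖x n‖ = 1) → ∀ n,
        ‖sphereTDFlow (G := fun _ : ℝ => loFlowAction κ S₀ U)
            (contDiff_const_family (contDiff_loFlowAction U κ S₀)) T t₀ t₁ x n - Ψ x n‖ ≤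
          2 * Real.exp (3 * |κ| * υ / ((Module.finrank ℝ E : ℝ) - 1) * |t₁ - t₀|) *
            (3 * |κ| * υ / ((Module.finrank ℝ E : ℝ) - 1) * |t₁ - t₀|) ^ (m + 1) / ((m + 1)! : ℝ) := by
  -- the empty lattice is trivial; otherwise `υ ≥ 0`
  rcases isEmpty_or_nonempty Λ with hΛ | hΛ
  · exact ⟨fun x => x, fun n => isEmptyElim n, fun x _ n => isEmptyElim n⟩
  have hd1 : 0 < (Module.finrank ℝ E : ℝ) - 1 := by
    have : (2 : ℝ) ≤ Module.finrank ℝ E := by exact_mod_cast hd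
    linarith
  have hυ0 : 0 ≤ υ :=
    le_trans (Finset.sum_nonneg fun m _ => norm_nonneg _) (hυ (Classical.arbitrary Λ))
  have hK : 0 ≤ 3 * |κ| * υ / ((Module.finrank ℝ E : ℝ) - 1) := div_nonneg (by positivity) hd1.le
  exact exists_local_approx_sphereTDFlow (G := fun _ : ℝ => loFlowAction κ S₀ U)
    (contDiff_const_family (contDiff_loFlowAction U κ S₀)) (fun n => insert n (couplingNbhd U n)) hK
    (fun _ _ x' y' hx' hy' i M hM hN =>
      norm_siteGrad_loFlowAction_sub_le_of_readSet hU0 hUadj hd κ S₀ hυ hx' hy' i hM hN)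
    m he

end Cone

end Summit.Ventures.LatticeQCDFlow.Exactness

end
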